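import Literature.Topology.FourManifolds.WrinkledFibrationMoveModels
import HarnessLib

/-!
# Lekili's flipping move: the double point of the flipped base diagram

Topic `Literature/Topology/FourManifolds`.  The flipping family
`F_s(t, x, y, z) = (t, x⁴ - x² s + x t + y² - z²)` (`flipMap s`,
`WrinkledFibrationMoveModels.lean`) has, for every `s`, the connected critical curve
`u ↦ (2 s u - 4 u³, u, 0, 0)` (`flipCurve s`), whose image — the base diagram — is the plane
curve `u ↦ (2 s u - 4 u³, s u² - 3 u⁴)`.  Lekili 2009, §3, Move 3: *"for `s<0`, the critical
value set consists of a simple curve … For `s>0`, we get a wrinkled map with critical value set,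
including two cusp singularities … This map still induces an immersion on the critical point
set away from the cusp singularities, however now we have a double point as shown in Figure 5"*.
The cusps are treated in `SuspendedFamilyCriticalImage.lean`; this file PROVES the statement
about the DOUBLE POINT (no named fact): the base diagram of `F_s` is embedded for `s ≤ 0` and
has exactly one double point for `s > 0`, the common image of the two critical points
`u = ±√(s/2)`.

* `flipMap_flipCurve` — the base diagram `(2 s u - 4 u³, s u² - 3 u⁴)`;
* `flipMap_flipCurve_eq_iff` — **two parameters have the same critical value iff they are equal,
  or opposite with `2u² = s`**;
* `injective_flip_image_of_nonpos` (`s ≤ 0`: no double point),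
  `flipMap_flipCurve_sqrt_eq` and `flipMap_flipCurve_eq_iff_of_ne` (`s > 0`: the unique double
  point).

## References

* Y. Lekili, *Wrinkled fibrations on near-symplectic manifolds*, Geom. Topol. 13 (2009)
  277–318 (arXiv:0712.2202), §3, Move 3 and Fig. 5. [Lekili2009]
* R. İ. Baykur, O. Saeki, *Simplifying indefinite fibrations on 4-manifolds*, arXiv:1705.11169,
  §3.1 (flip), §2.1 (round images with transverse double points). [BaykurSaeki2017]
-/

noncomputable section

open Set Function

namespace Literature.Topology.FourManifolds

/-- **The base diagram of the flipping family**: the critical value of the critical point with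
parameter `u` is `(2 s u - 4 u³, s u² - 3 u⁴)`. [cite: Lekili2009, §3 Move 3] -/
theorem flipMap_flipCurve (s u : ℝ) :
    flipMap s (flipCurve s u) = WithLp.toLp 2 ![2 * s * u - 4 * u ^ 3, s * u ^ 2 - 3 * u ^ 4] := by
  ext i
  fin_cases i
  · simp [flipMap, flipCurve]
  · simp [flipMap, flipCurve]
    ring

/-- First coordinate of the base diagram: `2 s u - 4 u³`. [folklore] -/
@[simp] theorem flipMap_flipCurve_apply_zero (s u : ℝ) :
    flipMap s (flipCurve s u) 0 = 2 * s * u - 4 * u ^ 3 := by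
  rw [flipMap_flipCurve]
  simp

/-- Second coordinate of the base diagram: `s u² - 3 u⁴`. [folklore] -/
@[simp] theorem flipMap_flipCurve_apply_one (s u : ℝ) :
    flipMap s (flipCurve s u) 1 = s * u ^ 2 - 3 * u ^ 4 := by
  rw [flipMap_flipCurve]
  simp

/-- **Double points of the flipped base diagram.**  Two critical points `u`, `u'` of `F_s` have
the same critical value iff `u = u'`, or `u' = -u` with `2u² = s`: from
`2su - 4u³ = 2su' - 4u'³` and `su² - 3u⁴ = su'² - 3u'⁴` one gets, for `u ≠ u'`,
`s = 2(u² + uu' + u'²)` and `(u + u')(s - 3(u² + u'²)) = 0`, and the second alternative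
forces `(u - u')² = 0`. [cite: Lekili2009, §3 Move 3] -/
theorem flipMap_flipCurve_eq_iff (s u u' : ℝ) :
    flipMap s (flipCurve s u) = flipMap s (flipCurve s u') ↔ u = u' ∨ (u' = -u ∧ 2 * u ^ 2 = s) := by
  constructor
  · intro h
    have h0 : 2 * s * u - 4 * u ^ 3 = 2 * s * u' - 4 * u' ^ 3 := by
      simpa using congrArg (fun w : EuclideanSpace ℝ (Fin 2) => w 0) h
    have h1 : s * u ^ 2 - 3 * u ^ 4 = s * u' ^ 2 - 3 * u' ^ 4 := by
      simpa using congrArg (fun w : EuclideanSpace ℝ (Fin 2) => w 1) h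
    rcases eq_or_ne u u' with huu | huu
    · exact Or.inl huu
    · right
      have hne : u - u' ≠ 0 := sub_ne_zero.mpr huu
      -- factor the two equations by `u - u'`
      have hA' : (u - u') * (2 * s - 4 * (u ^ 2 + u * u' + u' ^ 2)) = 0 := by
        linear_combination h0
      have hA : s = 2 * (u ^ 2 + u * u' + u' ^ 2) := by
        have := (mul_eq_zero.mp hA').resolve_left hne
        linarith
      have hB' : (u - u') * ((u + u') * (s - 3 * (u ^ 2 + u' ^ 2))) = 0 := by
        linear_combination h1
      have hB : (u + u') * (s - 3 * (u ^ 2 + u' ^ 2)) = 0 := (mul_eq_zero.mp hB').resolve_left hne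
      rcases mul_eq_zero.mp hB with hB | hB
      · have hu' : u' = -u := by linarith
        refine ⟨hu', ?_⟩
        rw [hu'] at hA
        linarith
      · exfalso
        have hsq : (u - u') ^ 2 = 0 := by nlinarith [hA, hB]
        exact hne (pow_eq_zero_iff (n := 2) (by norm_num) |>.mp hsq)
  · rintro (rfl | ⟨rfl, hs⟩)
    · rfl
    · rw [flipMap_flipCurve, flipMap_flipCurve]
      congr 1
      ext i
      fin_cases i
      · simp
        rw [← hs]
        ring
      · simp
        ring

/-- **Before and at the flip (`s ≤ 0`) the base diagram is embedded**: the critical image has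
no double point (*"for `s<0`, the critical value set consists of a simple curve"*).
[cite: Lekili2009, §3 Move 3] -/
theorem injective_flip_image_of_nonpos {s : ℝ} (hs : s ≤ 0) :
    Injective fun u => flipMap s (flipCurve s u) := by
  intro u u' h
  rcases (flipMap_flipCurve_eq_iff s u u').mp h with h | ⟨h', h2⟩
  · exact h
  · -- `2u² = s ≤ 0` forces `u = 0 = u'`
    have hu : u = 0 := by nlinarith [sq_nonneg u]
    subst hu
    simpa using h'.symm

/-- **After the flip (`s > 0`) the two critical points `u = ±√(s/2)` have the same critical
value** — the double point of Lekili's Fig. 5. [cite: Lekili2009, §3 Move 3] -/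
theorem flipMap_flipCurve_sqrt_eq {s : ℝ} (hs : 0 ≤ s) :
    flipMap s (flipCurve s (Real.sqrt (s / 2))) = flipMap s (flipCurve s (-Real.sqrt (s / 2))) :=
  (flipMap_flipCurve_eq_iff s _ _).mpr (Or.inr ⟨rfl, by rw [Real.sq_sqrt (by positivity)]; ring⟩)

/-- The two parameters of the double point are distinct for `s > 0`. [folklore] -/
theorem sqrt_half_ne_neg_sqrt_half {s : ℝ} (hs : 0 < s) :
    Real.sqrt (s / 2) ≠ -Real.sqrt (s / 2) := by
  have h : 0 < Real.sqrt (s / 2) := Real.sqrt_pos.mpr (by positivity)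
  linarith

/-- **Uniqueness of the double point** (`s > 0`): two DISTINCT critical points have the same
critical value iff they are the pair `±√(s/2)`. [cite: Lekili2009, §3 Move 3] -/
theorem flipMap_flipCurve_eq_iff_of_ne {s u u' : ℝ} (hs : 0 < s) (huu : u ≠ u') :
    flipMap s (flipCurve s u) = flipMap s (flipCurve s u') ↔
      (u = Real.sqrt (s / 2) ∧ u' = -Real.sqrt (s / 2)) ∨
        (u = -Real.sqrt (s / 2) ∧ u' = Real.sqrt (s / 2)) := by
  rw [flipMap_flipCurve_eq_iff]
  have h2 : (0 : ℝ) ≤ s / 2 := by positivity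
  constructor
  · rintro (h | ⟨h', hsq⟩)
    · exact absurd h huu
    · have hu2 : u ^ 2 = Real.sqrt (s / 2) ^ 2 := by
        rw [Real.sq_sqrt h2]
        linarith
      rcases sq_eq_sq_iff_eq_or_eq_neg.mp hu2 with hu | hu
      · exact Or.inl ⟨hu, by rw [h', hu]⟩
      · exact Or.inr ⟨hu, by rw [h', hu, neg_neg]⟩
  · rintro (⟨rfl, rfl⟩ | ⟨rfl, rfl⟩)
    · exact Or.inr ⟨rfl, by rw [Real.sq_sqrt h2]; ring⟩
    · exact Or.inr ⟨by rw [neg_neg], by rw [neg_sq, Real.sq_sqrt h2]; ring⟩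

end Literature.Topology.FourManifolds

end
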